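import Summits.QuantumFields.BalabanUV.Beta.GAN24.FineReadoutGradientDecay
import Literature.MathematicalPhysics.QuantumFieldTheory.Balaban1983to89.Beta.BalabanCompositeJets
import Literature.MathematicalPhysics.QuantumFieldTheory.Balaban1983to89.B4Reflection242

/-!
# `BalabanUV.Beta.GAN24.RespStepDecay` — binder row G-an2-4 / (CONV-C), W-slot road «W3» (gan24-p1-g5 `SKELETON-W3.md` v0.2 §7.3,
# RULINGS-13 (R13-2) invitation «W3-LEGS*», journal INTENT l.7566): (N1)∕(N1′)-TYPE SUP AND UNIT-GRADIENT BOUNDS FOR THE DECIMATED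
# COMPOSITE MINIMISER COLUMNS `respStep (Lc^m) (Lc^(m+k+1))` AT INTERMEDIATE `m`, UNIFORM IN `(m, k)` — the leg input of row family (F3)

NOT IN PRINT; OUR PROOF ATTEMPT (of the road; THIS file is [folklore] packaging: the triangle inequality over the `M^{d+1}·M` points of an
`M`-block contour + the floor arithmetic of block labels; the analytic CONTENT is leaf-16's (N1) `FineReadoutDecay.exists_wH_decay` and
leaf-19's (N1′) `FineReadoutGradientDecay.exists_wH_grad_decay`, consumed BY NAME through `FineReadoutGradientDecay.exists_wH_decay_and_grad`).
HONEST FRAMING (cell contract, verbatim): «discharging `BetaPertH` makes Bałaban's UV stability UNCONDITIONAL — a real constructive-QFT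
result; it is NOT the continuum limit and NOT the Clay problem.»  HONEST DEPENDENCY (verbatim): «continuum YM on T⁴ ⇐ BetaPertH ∧ nine spine
estimates (0/9 proved); BetaPertH ⇐ (D1) ∧ (D4) ∧ CAP+tail; G-an2-4 gates asym, D1 and NE2/3/4.»  No cited fact, no wall binder, no `def`,
no `def … : Prop`; discharges NOTHING of «T2Shape» ∕ «T2SupRate» ∕ (hW₂, hW₂all); (T-marg) ∕ (T-irr) are NOT claimed; NOT a LEAVES row;
0∕2 wall binders instantiated; NOT `BetaPertH`, NOT continuum, NOT Clay.

## The object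
an2's (K1b′) response family `BalabanCompositeJets.respStep M N′ μ z l″ w′ := contourSum M (Hcol (N := N′) μ z) l″ w′`
`= Σ_{b ∈ box M} Σ_{s < M} wH (N := N′) l″ μ (M•w′ + b + s•e_{l″} − N′•z)` — the `M`-block-contour sum, at the level-`M` bond `(l″, w′)`, of the
level-`N′` minimiser column with source bond `(μ, z)`.  For `M = Lc^m`, `N′ = Lc^n` these are the DECIMATED COMPOSITE MINIMISER COLUMNS that
carry the `(n − m)`-fold composite push of SKELETON-W3 §2 W3-L1 ∕ §7.3; `M = 1` is `Hcol` itself, i.e. (N1)∕(N1′).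

## What is proved
* §1 (generic `d`) block-label arithmetic: `quo_zsmul_add_sub_zsmul` (`quo (M·L) (M•w′ + r − (M·L)•z) = quo L (w′ + quo M r) − z`),
  `quo_nonneg_le_of_lt` (`0 ≤ rᵢ < (n+1)·M ⇒ 0 ≤ (quo M r)ᵢ ≤ n`), `abs_quo_add_sub_quo_le`, **`supNorm_quo_sub_le_add`**: for an offset `r`
  with `0 ≤ rᵢ < (n+1)·M`, `‖quo L w′ − z‖∞ ≤ ‖quo (M·L) (M•w′ + r − (M·L)•z)‖∞ + n` — the relative block label of a contour point is the
  block label of its base point up to `n`; `exp_wobble` (the resulting factor `e^{n·κ₀}` on a decaying envelope); `contour_offset_lt` ∕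
  `contour_offset_lt₂` (the offsets `b + s•e_κ (+ t•e_ν)` of an `M`-block contour are `< 2M` (`< 3M`)); `card_box_mul_card_range` (`M^{d+1}·M = M^{d+2}`).
* §2 (generic `d`, any `M, L ≥ 1`, `N′ = M·L`) `respStep_eq_sum` (the contour sum unfolded), `respStep_one` (`M = 1`:
  `respStep 1 N′ μ z l″ w′ = wH l″ μ (w′ − N′•z)`, the translated minimiser column itself), and THE SMEARING LEMMAS: **`abs_respStep_le`** — a pointwise envelope
  `|wH (N := N′) κ l v| ≤ A·e^{−κ₀‖quo N′ v‖∞}` gives `|respStep M N′ μ z l″ w′| ≤ (M^{d+2}·A·e^{κ₀})·e^{−κ₀‖quo L w′ − z‖∞}`;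
  **`abs_respStep_sub_le`** — a unit-gradient envelope `|wH κ l (v + e_ν) − wH κ l v| ≤ A′·e^{−κ₀‖quo N′ v‖∞}` gives
  `|respStep M N′ μ z l″ (w′ + e_ν) − respStep M N′ μ z l″ w′| ≤ (M^{d+2}·M·A′·e^{2κ₀})·e^{−κ₀‖quo L w′ − z‖∞}` (the shift `M•e_ν` of every
  contour point telescoped into `M` unit steps); `respStep_translate` (joint covariance `(z, w′) ↦ (z + t, w′ + L•t)`).
* §3 (`d = 3`, every blocking factor `Lc ≥ 1`) **`exists_respStep_decay_and_grad`**: ONE rate `κ₀ > 0` and constants `C, C′ ≥ 0` with, for ALL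
  `m k μ z l″ w′ ν`,
  `|respStep (Lc^m) (Lc^(m+k+1)) μ z l″ w′| ≤ C·((Lc^(k+1))^5)⁻¹·e^{−κ₀‖quo (Lc^(k+1)) w′ − z‖∞}` and
  `|respStep (Lc^m) (Lc^(m+k+1)) μ z l″ (w′ + e_ν) − respStep (Lc^m) (Lc^(m+k+1)) μ z l″ w′| ≤ C′·((Lc^(k+1))^6)⁻¹·e^{−κ₀‖quo (Lc^(k+1)) w′ − z‖∞}`
  — (N1) ∧ (N1′) READ ON THE `Lc^m`-LATTICE: the power count is exact (`M^{d+2}·(N′^{d+2})⁻¹ = (L^{d+2})⁻¹`, `M^{d+3}·(N′^{d+3})⁻¹ = (L^{d+3})⁻¹`,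
  `L = Lc^(k+1)` the RELATIVE blocking), the rate is the one of `exists_wH_decay_and_grad`, the constants are OUTSIDE every `∀`.
Unit `b2b-balaban-gan24-formalise-leaf-12` (G-an2-4 formalisation swarm, leaf prover 12, gen 20; idle-seat one-shot piece «W3-LEGS*»), 2026-08-20.
-/

noncomputable section

open Finset
open scoped BigOperators
open Literature.MathematicalPhysics.QuantumFieldTheory.LatticeForm (quo)
open Literature.MathematicalPhysics.QuantumFieldTheory.Balaban1983to89
open Literature.MathematicalPhysics.QuantumFieldTheory.Balaban1983to89.Beta
open B4ContourShift (supNorm abs_le_supNorm supNorm_nonneg exists_supNorm_eq)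
open B4Reflection242 (supNorm_le_of_forall supNorm_add_le)
open BlochFibreUniqueness (quo_add_zsmul)
open KernelSpecInstance (wH)
open AffineAveraging (contourSum Form1 box toSite unitVec)
open ResolventComposition (Hcol Hcol_apply)
open BalabanCompositeJets (respStep)

namespace Summit.QuantumFields.BalabanUV.Beta.GAN24.RespStepDecay

variable {d : ℕ}

/-! ## §1 Block-label arithmetic for the points of an `M`-block contour -/

/-- [folklore] Nested block labels with a coarse shift: `quo (M·L) (M•w′ + r − (M·L)•z) = quo L (w′ + quo M r) − z`. -/
theorem quo_zsmul_add_sub_zsmul (M L : ℕ) [NeZero M] [NeZero L] (w' r z : Fin (d + 1) → ℤ) :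
    quo (M * L) ((M : ℤ) • w' + r - ((M * L : ℕ) : ℤ) • z) = quo L (w' + quo M r) - z := by
  haveI : NeZero (M * L) := ⟨mul_ne_zero (NeZero.ne M) (NeZero.ne L)⟩
  have h1 : quo (M * L) ((M : ℤ) • w' + r - ((M * L : ℕ) : ℤ) • z) = quo (M * L) ((M : ℤ) • w' + r) + (-z) := by
    rw [← quo_add_zsmul ((M : ℤ) • w' + r) (-z), smul_neg, sub_eq_add_neg]
  have h2 : quo (M * L) ((M : ℤ) • w' + r) = quo L (quo M ((M : ℤ) • w' + r)) := by
    funext j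
    simp only [quo, Nat.cast_mul]
    exact (Int.ediv_ediv_of_nonneg (Int.natCast_nonneg M)).symm
  have h3 : quo M ((M : ℤ) • w' + r) = w' + quo M r := by
    rw [add_comm ((M : ℤ) • w') r, quo_add_zsmul r w']
    exact add_comm _ _
  rw [h1, h2, h3, ← sub_eq_add_neg]

/-- [folklore] An offset of size `< (n+1)·M` has `M`-block label in `{0, …, n}` coordinatewise. -/
theorem quo_nonneg_le_of_lt (M : ℕ) [NeZero M] {n : ℕ} {r : Fin (d + 1) → ℤ}
    (hr : ∀ i, 0 ≤ r i ∧ r i < ((n + 1 : ℕ) : ℤ) * (M : ℤ)) (i : Fin (d + 1)) :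
    0 ≤ quo M r i ∧ quo M r i ≤ (n : ℤ) := by
  have hM : (0 : ℤ) < M := by exact_mod_cast Nat.pos_of_ne_zero (NeZero.ne M)
  obtain ⟨h0, hlt⟩ := hr i
  refine ⟨Int.ediv_nonneg h0 hM.le, ?_⟩
  have h : r i / (M : ℤ) < ((n + 1 : ℕ) : ℤ) := (Int.ediv_lt_iff_lt_mul hM).2 hlt
  simp only [quo]
  push_cast at h
  omega

/-- [folklore] Adding an offset `e` with `0 ≤ eᵢ ≤ n` moves the `L`-block label by at most `n` coordinatewise (`L ≥ 1`). -/
theorem abs_quo_add_sub_quo_le (L : ℕ) [NeZero L] {n : ℕ} {w' e : Fin (d + 1) → ℤ}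
    (he : ∀ i, 0 ≤ e i ∧ e i ≤ (n : ℤ)) (i : Fin (d + 1)) :
    |quo L (w' + e) i - quo L w' i| ≤ (n : ℤ) := by
  have hL : (0 : ℤ) < L := by exact_mod_cast Nat.pos_of_ne_zero (NeZero.ne L)
  have hL1 : (1 : ℤ) ≤ L := hL
  obtain ⟨h0, hn⟩ := he i
  simp only [quo, Pi.add_apply]
  have hlo : w' i / (L : ℤ) ≤ (w' i + e i) / (L : ℤ) := Int.ediv_le_ediv hL (by omega)
  have hhi : (w' i + e i) / (L : ℤ) ≤ w' i / (L : ℤ) + n := by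
    have h1 : w' i + e i ≤ w' i + (n : ℤ) * (L : ℤ) := by nlinarith
    calc (w' i + e i) / (L : ℤ) ≤ (w' i + (n : ℤ) * (L : ℤ)) / (L : ℤ) := Int.ediv_le_ediv hL h1
      _ = w' i / (L : ℤ) + n := Int.add_mul_ediv_right _ _ hL.ne'
  rw [abs_le]; constructor <;> linarith

/-- [folklore] **THE RELATIVE BLOCK LABEL OF A CONTOUR POINT**: for an offset `r` with `0 ≤ rᵢ < (n+1)·M`,
`‖quo L w′ − z‖∞ ≤ ‖quo (M·L) (M•w′ + r − (M·L)•z)‖∞ + n`. -/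
theorem supNorm_quo_sub_le_add (M L : ℕ) [NeZero M] [NeZero L] {n : ℕ} (w' z : Fin (d + 1) → ℤ) {r : Fin (d + 1) → ℤ}
    (hr : ∀ i, 0 ≤ r i ∧ r i < ((n + 1 : ℕ) : ℤ) * (M : ℤ)) :
    supNorm (quo L w' - z) ≤ supNorm (quo (M * L) ((M : ℤ) • w' + r - ((M * L : ℕ) : ℤ) • z)) + n := by
  rw [quo_zsmul_add_sub_zsmul]
  have he : ∀ i, 0 ≤ quo M r i ∧ quo M r i ≤ (n : ℤ) := quo_nonneg_le_of_lt M hr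
  refine supNorm_le_of_forall fun i => ?_
  have h1 : |(quo L w' - z) i| ≤ |(quo L (w' + quo M r) - z) i| + n := by
    have h := abs_quo_add_sub_quo_le L he i (w' := w')
    simp only [Pi.sub_apply]
    have htri := abs_sub_le (quo L w' i - z i) (quo L (w' + quo M r) i - z i) 0
    simp only [sub_zero] at htri
    rw [show quo L w' i - z i - (quo L (w' + quo M r) i - z i) = -(quo L (w' + quo M r) i - quo L w' i) by ring, abs_neg] at htri
    linarith
  have h2 : (((|(quo L (w' + quo M r) - z) i| : ℤ) : ℝ)) ≤ supNorm (quo L (w' + quo M r) - z) := abs_le_supNorm _ i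
  have h3 : (((|(quo L w' - z) i| : ℤ) : ℝ)) ≤ (((|(quo L (w' + quo M r) - z) i| : ℤ) : ℝ)) + (n : ℝ) := by exact_mod_cast h1
  linarith

/-- [folklore] The wobble factor: `e^{−κ₀ s′} ≤ e^{n κ₀}·e^{−κ₀ s}` whenever `s ≤ s′ + n`, `κ₀ ≥ 0`. -/
theorem exp_wobble {κ₀ s s' : ℝ} {n : ℕ} (hκ : 0 ≤ κ₀) (h : s ≤ s' + n) :
    Real.exp (-(κ₀ * s')) ≤ Real.exp (n * κ₀) * Real.exp (-(κ₀ * s)) := by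
  rw [← Real.exp_add]
  exact Real.exp_le_exp.2 (by nlinarith)

/-- [folklore] The offsets of an `M`-block contour: `0 ≤ (b + s•e_κ)ᵢ < 2M` for `b ∈ box M`, `s < M`. -/
theorem contour_offset_lt {M : ℕ} {b : Fin (d + 1) → ℕ} (hb : b ∈ box (d + 1) M) {s : ℕ} (hs : s < M) (κ i : Fin (d + 1)) :
    0 ≤ (toSite b + (s : ℤ) • unitVec κ) i ∧ (toSite b + (s : ℤ) • unitVec κ) i < ((1 + 1 : ℕ) : ℤ) * (M : ℤ) := by
  have hbi : b i < M := Finset.mem_range.1 (Fintype.mem_piFinset.1 hb i)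
  simp only [Pi.add_apply, Pi.smul_apply, AffineAveraging.unitVec_apply, smul_eq_mul, toSite]
  split_ifs
  · constructor <;> push_cast <;> omega
  · constructor <;> push_cast <;> omega

/-- [folklore] The same with one more unit-contour piece: `0 ≤ (b + s•e_κ + t•e_ν)ᵢ < 3M` for `b ∈ box M`, `s, t < M`. -/
theorem contour_offset_lt₂ {M : ℕ} {b : Fin (d + 1) → ℕ} (hb : b ∈ box (d + 1) M) {s t : ℕ} (hs : s < M) (ht : t < M)
    (κ ν i : Fin (d + 1)) :
    0 ≤ (toSite b + (s : ℤ) • unitVec κ + (t : ℤ) • unitVec ν) i ∧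
      (toSite b + (s : ℤ) • unitVec κ + (t : ℤ) • unitVec ν) i < ((2 + 1 : ℕ) : ℤ) * (M : ℤ) := by
  have hbi : b i < M := Finset.mem_range.1 (Fintype.mem_piFinset.1 hb i)
  simp only [Pi.add_apply, Pi.smul_apply, AffineAveraging.unitVec_apply, smul_eq_mul, toSite]
  split_ifs <;> constructor <;> push_cast <;> omega

/-- [folklore] `#(box (d+1) M) · #(range M) = M^{d+2}` as a real number. -/
theorem card_box_mul_card_range (M : ℕ) :
    (((box (d + 1) M).card : ℝ)) * ((Finset.range M).card : ℝ) = (M : ℝ) ^ (d + 2) := by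
  have hcard : (box (d + 1) M).card = M ^ (d + 1) := by
    unfold AffineAveraging.box
    rw [Fintype.card_piFinset, Finset.prod_const, Finset.card_range, Finset.card_univ, Fintype.card_fin]
  rw [hcard, Finset.card_range]
  push_cast
  ring

/-! ## §2 The smearing lemmas: an envelope of `wH` at blocking `N′ = M·L` is read by the `M`-block contour -/

section Smearing

variable {M L N' : ℕ} [NeZero M] [NeZero L] [NeZero N']

/-- [folklore] The summand of `respStep`, unfolded. -/
theorem respStep_eq_sum (M N' : ℕ) [NeZero N'] (μ : Fin (d + 1)) (z : Fin (d + 1) → ℤ) (l'' : Fin (d + 1)) (w' : Fin (d + 1) → ℤ) :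
    respStep (d := d) M N' μ z l'' w' = ∑ b ∈ box (d + 1) M, ∑ s ∈ Finset.range M,
      wH (N := N') l'' μ ((M : ℤ) • w' + (toSite b + (s : ℤ) • unitVec l'') - (N' : ℤ) • z) := by
  unfold respStep contourSum
  refine Finset.sum_congr rfl fun b _ => Finset.sum_congr rfl fun s _ => ?_
  rw [Hcol_apply, add_assoc]

omit [NeZero N'] in
/-- [folklore] `M = 1`: the response family IS the translated minimiser column, `respStep 1 N′ μ z l″ w′ = wH l″ μ (w′ − N′•z)` — so at the
finest read-out level the bounds below are (N1)∕(N1′) themselves. -/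
theorem respStep_one (N' : ℕ) [NeZero N'] (μ : Fin (d + 1)) (z : Fin (d + 1) → ℤ) (l'' : Fin (d + 1)) (w' : Fin (d + 1) → ℤ) :
    respStep (d := d) 1 N' μ z l'' w' = wH (N := N') l'' μ (w' - (N' : ℤ) • z) := by
  rw [respStep_eq_sum]
  have hbox : box (d + 1) 1 = {fun _ => 0} := by
    unfold AffineAveraging.box
    rw [Finset.range_one, Fintype.piFinset_singleton]
  rw [hbox, Finset.sum_singleton, Finset.range_one, Finset.sum_singleton]
  congr 1
  funext i
  simp

/-- [folklore] **(N1)-TYPE SMEARING**: a pointwise block-decaying envelope of the level-`N′` minimiser column, `N′ = M·L`,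
`|wH (N := N′) κ l v| ≤ A·e^{−κ₀‖quo N′ v‖∞}`, is read by the `M`-block contour as
`|respStep M N′ μ z l″ w′| ≤ (M^{d+2}·A·e^{κ₀})·e^{−κ₀‖quo L w′ − z‖∞}` — `M^{d+1}·M` contour points, each at relative block label
`quo L w′ − z` up to one block. -/
theorem abs_respStep_le (hN : N' = M * L) {A κ₀ : ℝ} (hA : 0 ≤ A) (hκ : 0 ≤ κ₀)
    (hwH : ∀ (κ l : Fin (d + 1)) (v : Fin (d + 1) → ℤ), |wH (N := N') κ l v| ≤ A * Real.exp (-(κ₀ * supNorm (quo N' v))))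
    (μ : Fin (d + 1)) (z : Fin (d + 1) → ℤ) (l'' : Fin (d + 1)) (w' : Fin (d + 1) → ℤ) :
    |respStep (d := d) M N' μ z l'' w'| ≤
      ((M : ℝ) ^ (d + 2) * A * Real.exp κ₀) * Real.exp (-(κ₀ * supNorm (quo L w' - z))) := by
  subst hN
  rw [respStep_eq_sum]
  have hterm : ∀ b ∈ box (d + 1) M, ∀ s ∈ Finset.range M,
      |wH (N := M * L) l'' μ ((M : ℤ) • w' + (toSite b + (s : ℤ) • unitVec l'') - ((M * L : ℕ) : ℤ) • z)| ≤
        A * Real.exp κ₀ * Real.exp (-(κ₀ * supNorm (quo L w' - z))) := by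
    intro b hb s hs
    have hs' : s < M := Finset.mem_range.1 hs
    have hr := fun i => contour_offset_lt (d := d) hb hs' l'' i
    have hlab := supNorm_quo_sub_le_add M L w' z hr (n := 1)
    refine (hwH l'' μ _).trans ?_
    have hw := exp_wobble hκ hlab
    rw [Nat.cast_one, one_mul] at hw
    calc A * Real.exp (-(κ₀ * supNorm (quo (M * L) ((M : ℤ) • w' + (toSite b + (s : ℤ) • unitVec l'') - ((M * L : ℕ) : ℤ) • z))))
        ≤ A * (Real.exp κ₀ * Real.exp (-(κ₀ * supNorm (quo L w' - z)))) := mul_le_mul_of_nonneg_left hw hA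
      _ = A * Real.exp κ₀ * Real.exp (-(κ₀ * supNorm (quo L w' - z))) := by ring
  have hNcast : (((M * L : ℕ) : ℤ)) = ((M * L : ℕ) : ℤ) := rfl
  calc |∑ b ∈ box (d + 1) M, ∑ s ∈ Finset.range M,
          wH (N := M * L) l'' μ ((M : ℤ) • w' + (toSite b + (s : ℤ) • unitVec l'') - ((M * L : ℕ) : ℤ) • z)|
      ≤ ∑ b ∈ box (d + 1) M, ∑ s ∈ Finset.range M,
          |wH (N := M * L) l'' μ ((M : ℤ) • w' + (toSite b + (s : ℤ) • unitVec l'') - ((M * L : ℕ) : ℤ) • z)| :=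
        (abs_sum_le_sum_abs _ _).trans (sum_le_sum fun b _ => abs_sum_le_sum_abs _ _)
    _ ≤ ∑ b ∈ box (d + 1) M, ∑ _s ∈ Finset.range M, A * Real.exp κ₀ * Real.exp (-(κ₀ * supNorm (quo L w' - z))) :=
        sum_le_sum fun b hb => sum_le_sum fun s hs => hterm b hb s hs
    _ = ((M : ℝ) ^ (d + 2) * A * Real.exp κ₀) * Real.exp (-(κ₀ * supNorm (quo L w' - z))) := by
        rw [sum_const, sum_const, smul_smul, nsmul_eq_mul, Nat.cast_mul, card_box_mul_card_range]
        ring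

/-- [folklore] Telescoping a shift by `M•e_ν` into `M` unit steps. -/
theorem sub_eq_sum_range_step (f : (Fin (d + 1) → ℤ) → ℝ) (v : Fin (d + 1) → ℤ) (ν : Fin (d + 1)) (M : ℕ) :
    f (v + (M : ℤ) • unitVec ν) - f v =
      ∑ t ∈ Finset.range M, (f (v + (t : ℤ) • unitVec ν + Pi.single ν 1) - f (v + (t : ℤ) • unitVec ν)) := by
  have h : ∀ t : ℕ, f (v + (t : ℤ) • unitVec ν + Pi.single ν 1) = f (v + ((t + 1 : ℕ) : ℤ) • unitVec ν) := by
    intro t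
    congr 1
    rw [Nat.cast_add, Nat.cast_one, add_smul, one_smul, add_assoc]
    rfl
  simp only [h]
  rw [Finset.sum_range_sub (fun t => f (v + (t : ℤ) • unitVec ν)) M]
  simp

/-- [folklore] **(N1′)-TYPE SMEARING**: a unit-gradient block-decaying envelope of the level-`N′` minimiser column, `N′ = M·L`,
`|wH κ l (v + e_ν) − wH κ l v| ≤ A′·e^{−κ₀‖quo N′ v‖∞}`, is read by the `M`-block contour as
`|respStep M N′ μ z l″ (w′ + e_ν) − respStep M N′ μ z l″ w′| ≤ (M^{d+2}·M·A′·e^{2κ₀})·e^{−κ₀‖quo L w′ − z‖∞}` — the unit step of the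
level-`M` position is the shift `M•e_ν` of every contour point, i.e. `M` unit steps of the fine argument. -/
theorem abs_respStep_sub_le (hN : N' = M * L) {A' κ₀ : ℝ} (hA : 0 ≤ A') (hκ : 0 ≤ κ₀)
    (hwH' : ∀ (κ l : Fin (d + 1)) (v : Fin (d + 1) → ℤ) (ν : Fin (d + 1)),
      |wH (N := N') κ l (v + Pi.single ν 1) - wH (N := N') κ l v| ≤ A' * Real.exp (-(κ₀ * supNorm (quo N' v))))
    (μ : Fin (d + 1)) (z : Fin (d + 1) → ℤ) (l'' : Fin (d + 1)) (w' : Fin (d + 1) → ℤ) (ν : Fin (d + 1)) :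
    |respStep (d := d) M N' μ z l'' (w' + Pi.single ν 1) - respStep (d := d) M N' μ z l'' w'| ≤
      ((M : ℝ) ^ (d + 2) * M * A' * Real.exp (2 * κ₀)) * Real.exp (-(κ₀ * supNorm (quo L w' - z))) := by
  subst hN
  rw [respStep_eq_sum, respStep_eq_sum, ← Finset.sum_sub_distrib]
  simp only [← Finset.sum_sub_distrib]
  -- the point of the shifted contour is the old point moved by `M•e_ν`
  have hpt : ∀ (b : Fin (d + 1) → ℕ) (s : ℕ),
      (M : ℤ) • (w' + Pi.single ν 1) + (toSite b + (s : ℤ) • unitVec l'') - ((M * L : ℕ) : ℤ) • z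
        = ((M : ℤ) • w' + (toSite b + (s : ℤ) • unitVec l'') - ((M * L : ℕ) : ℤ) • z) + (M : ℤ) • unitVec ν := by
    intro b s
    rw [smul_add]
    simp only [unitVec]
    abel
  have hterm : ∀ b ∈ box (d + 1) M, ∀ s ∈ Finset.range M,
      |wH (N := M * L) l'' μ ((M : ℤ) • (w' + Pi.single ν 1) + (toSite b + (s : ℤ) • unitVec l'') - ((M * L : ℕ) : ℤ) • z)
        - wH (N := M * L) l'' μ ((M : ℤ) • w' + (toSite b + (s : ℤ) • unitVec l'') - ((M * L : ℕ) : ℤ) • z)| ≤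
        (M : ℝ) * (A' * Real.exp (2 * κ₀) * Real.exp (-(κ₀ * supNorm (quo L w' - z)))) := by
    intro b hb s hs
    have hs' : s < M := Finset.mem_range.1 hs
    rw [hpt b s, sub_eq_sum_range_step (fun v => wH (N := M * L) l'' μ v)]
    have hstep : ∀ t ∈ Finset.range M,
        |wH (N := M * L) l'' μ ((M : ℤ) • w' + (toSite b + (s : ℤ) • unitVec l'') - ((M * L : ℕ) : ℤ) • z + (t : ℤ) • unitVec ν
              + Pi.single ν 1)
          - wH (N := M * L) l'' μ ((M : ℤ) • w' + (toSite b + (s : ℤ) • unitVec l'') - ((M * L : ℕ) : ℤ) • z + (t : ℤ) • unitVec ν)| ≤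
          A' * Real.exp (2 * κ₀) * Real.exp (-(κ₀ * supNorm (quo L w' - z))) := by
      intro t ht
      have ht' : t < M := Finset.mem_range.1 ht
      have hr := fun i => contour_offset_lt₂ (d := d) hb hs' ht' l'' ν i
      have hlab := supNorm_quo_sub_le_add M L w' z hr (n := 2)
      have hv : (M : ℤ) • w' + (toSite b + (s : ℤ) • unitVec l'') - ((M * L : ℕ) : ℤ) • z + (t : ℤ) • unitVec ν
          = (M : ℤ) • w' + (toSite b + (s : ℤ) • unitVec l'' + (t : ℤ) • unitVec ν) - ((M * L : ℕ) : ℤ) • z := by abel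
      rw [hv]
      refine (hwH' l'' μ _ ν).trans ?_
      have hw := exp_wobble hκ hlab
      rw [Nat.cast_ofNat] at hw
      calc A' * Real.exp (-(κ₀ * supNorm (quo (M * L)
              ((M : ℤ) • w' + (toSite b + (s : ℤ) • unitVec l'' + (t : ℤ) • unitVec ν) - ((M * L : ℕ) : ℤ) • z))))
          ≤ A' * (Real.exp (2 * κ₀) * Real.exp (-(κ₀ * supNorm (quo L w' - z)))) := mul_le_mul_of_nonneg_left hw hA
        _ = A' * Real.exp (2 * κ₀) * Real.exp (-(κ₀ * supNorm (quo L w' - z))) := by ring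
    calc |∑ t ∈ Finset.range M, _| ≤ ∑ t ∈ Finset.range M, _ := abs_sum_le_sum_abs _ _
      _ ≤ ∑ _t ∈ Finset.range M, A' * Real.exp (2 * κ₀) * Real.exp (-(κ₀ * supNorm (quo L w' - z))) :=
          sum_le_sum fun t ht => hstep t ht
      _ = (M : ℝ) * (A' * Real.exp (2 * κ₀) * Real.exp (-(κ₀ * supNorm (quo L w' - z)))) := by
          rw [sum_const, Finset.card_range, nsmul_eq_mul]
  calc |∑ b ∈ box (d + 1) M, ∑ s ∈ Finset.range M,
          (wH (N := M * L) l'' μ ((M : ℤ) • (w' + Pi.single ν 1) + (toSite b + (s : ℤ) • unitVec l'') - ((M * L : ℕ) : ℤ) • z)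
            - wH (N := M * L) l'' μ ((M : ℤ) • w' + (toSite b + (s : ℤ) • unitVec l'') - ((M * L : ℕ) : ℤ) • z))|
      ≤ ∑ b ∈ box (d + 1) M, ∑ s ∈ Finset.range M,
          |wH (N := M * L) l'' μ ((M : ℤ) • (w' + Pi.single ν 1) + (toSite b + (s : ℤ) • unitVec l'') - ((M * L : ℕ) : ℤ) • z)
            - wH (N := M * L) l'' μ ((M : ℤ) • w' + (toSite b + (s : ℤ) • unitVec l'') - ((M * L : ℕ) : ℤ) • z)| :=
        (abs_sum_le_sum_abs _ _).trans (sum_le_sum fun b _ => abs_sum_le_sum_abs _ _)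
    _ ≤ ∑ b ∈ box (d + 1) M, ∑ _s ∈ Finset.range M,
          (M : ℝ) * (A' * Real.exp (2 * κ₀) * Real.exp (-(κ₀ * supNorm (quo L w' - z)))) :=
        sum_le_sum fun b hb => sum_le_sum fun s hs => hterm b hb s hs
    _ = ((M : ℝ) ^ (d + 2) * M * A' * Real.exp (2 * κ₀)) * Real.exp (-(κ₀ * supNorm (quo L w' - z))) := by
        rw [sum_const, sum_const, smul_smul, nsmul_eq_mul, Nat.cast_mul, card_box_mul_card_range]
        ring

omit [NeZero M] [NeZero L] in
/-- [folklore] **JOINT BLOCK COVARIANCE** of the response family (`N′ = M·L`): moving the source bond by a coarse vector `t` and the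
read-out bond by `L•t` changes nothing — `respStep M N′ μ (z + t) l″ (w′ + L•t) = respStep M N′ μ z l″ w′`. -/
theorem respStep_translate (hN : N' = M * L) (μ : Fin (d + 1)) (z : Fin (d + 1) → ℤ) (l'' : Fin (d + 1))
    (w' t : Fin (d + 1) → ℤ) :
    respStep (d := d) M N' μ (z + t) l'' (w' + (L : ℤ) • t) = respStep (d := d) M N' μ z l'' w' := by
  subst hN
  rw [respStep_eq_sum, respStep_eq_sum]
  refine Finset.sum_congr rfl fun b _ => Finset.sum_congr rfl fun s _ => ?_
  congr 1
  rw [smul_add, smul_add, smul_smul, Nat.cast_mul]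
  abel

end Smearing

/-! ## §3 `d = 3`: (N1) ∧ (N1′) for the decimated composite columns at every intermediate level, unconditionally -/

section Four

variable {Lc : ℕ} [NeZero Lc]

/-- NOT IN PRINT; OUR PROOF ([folklore] packaging of leaf-16's (N1) and leaf-19's (N1′), `FineReadoutGradientDecay.exists_wH_decay_and_grad` BY NAME).
**(N1) ∧ (N1′) FOR THE DECIMATED COMPOSITE MINIMISER COLUMNS, UNIFORMLY IN THE PAIR OF LEVELS** (`d = 3`, every blocking factor `Lc ≥ 1`):
ONE rate `κ₀ > 0` and constants `C, C′ ≥ 0` such that for ALL `m k` (read-out level `Lc^m`, source level `Lc^(m+k+1)`, relative blocking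
`L = Lc^(k+1)`), all bonds `(μ, z)`, `(l″, w′)` and directions `ν`,
`|respStep (Lc^m) (Lc^(m+k+1)) μ z l″ w′| ≤ C·((Lc^(k+1))^5)⁻¹·e^{−κ₀‖quo (Lc^(k+1)) w′ − z‖∞}` and
`|respStep (Lc^m) (Lc^(m+k+1)) μ z l″ (w′ + e_ν) − respStep (Lc^m) (Lc^(m+k+1)) μ z l″ w′| ≤ C′·((Lc^(k+1))^6)⁻¹·e^{−κ₀‖quo (Lc^(k+1)) w′ − z‖∞}`:
in level-`Lc^m` lattice units the response to a level-`Lc^(m+k+1)` bond is `O(L^{−(d+2)})` pointwise, its unit gradient one `1∕L` better, both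
with exponential decay on the `L`-block scale — the shape of (N1)∕(N1′) with the ABSOLUTE blocking replaced by the RELATIVE one
(`m = 0`: (N1)∕(N1′) themselves, `respStep 1 N′ μ z l″ w′ = wH l″ μ (w′ − N′•z)`). -/
theorem exists_respStep_decay_and_grad :
    ∃ κ₀ C C' : ℝ, 0 < κ₀ ∧ 0 ≤ C ∧ 0 ≤ C' ∧
      (∀ (m k : ℕ) (μ : Fin (3 + 1)) (z : Fin (3 + 1) → ℤ) (l'' : Fin (3 + 1)) (w' : Fin (3 + 1) → ℤ),
        |respStep (d := 3) (Lc ^ m) (Lc ^ (m + k + 1)) μ z l'' w'| ≤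
          C * ((((Lc ^ (k + 1) : ℕ) : ℝ)) ^ (3 + 2))⁻¹ * Real.exp (-(κ₀ * supNorm (quo (Lc ^ (k + 1)) w' - z)))) ∧
      (∀ (m k : ℕ) (μ : Fin (3 + 1)) (z : Fin (3 + 1) → ℤ) (l'' : Fin (3 + 1)) (w' : Fin (3 + 1) → ℤ) (ν : Fin (3 + 1)),
        |respStep (d := 3) (Lc ^ m) (Lc ^ (m + k + 1)) μ z l'' (w' + Pi.single ν 1)
            - respStep (d := 3) (Lc ^ m) (Lc ^ (m + k + 1)) μ z l'' w'| ≤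
          C' * ((((Lc ^ (k + 1) : ℕ) : ℝ)) ^ (3 + 3))⁻¹ * Real.exp (-(κ₀ * supNorm (quo (Lc ^ (k + 1)) w' - z)))) := by
  obtain ⟨κ₀, C, C', hκ₀, hC, hC', hN1, hN1'⟩ := FineReadoutGradientDecay.exists_wH_decay_and_grad (Lc := Lc)
  have hL : (0 : ℝ) < (Lc : ℝ) := by exact_mod_cast Nat.pos_of_ne_zero (NeZero.ne Lc)
  refine ⟨κ₀, C * Real.exp κ₀, C' * Real.exp (2 * κ₀), hκ₀, by positivity, by positivity,
    fun m k μ z l'' w' => ?_, fun m k μ z l'' w' ν => ?_⟩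
  · -- (N1) at blocking `N′ = Lc^(m+k+1) = Lc^m · Lc^(k+1)`, envelope `A = C·(N′^5)⁻¹`
    have hN : Lc ^ (m + k + 1) = Lc ^ m * Lc ^ (k + 1) := by rw [← pow_add, add_assoc]
    have hj : m + k + 1 = (m + k) + 1 := rfl
    have hA : 0 ≤ C * ((((Lc ^ (m + k + 1) : ℕ) : ℝ)) ^ (3 + 2))⁻¹ := by positivity
    have h := abs_respStep_le (d := 3) (M := Lc ^ m) (L := Lc ^ (k + 1)) hN hA hκ₀.le
      (fun κ l v => hN1 (m + k) κ l v) μ z l'' w'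
    refine h.trans (le_of_eq ?_)
    have e : (((Lc ^ m : ℕ) : ℝ)) ^ (3 + 2) * ((((Lc ^ (m + k + 1) : ℕ) : ℝ)) ^ (3 + 2))⁻¹
        = ((((Lc ^ (k + 1) : ℕ) : ℝ)) ^ (3 + 2))⁻¹ := by
      push_cast
      rw [show (Lc : ℝ) ^ (m + k + 1) = (Lc : ℝ) ^ m * (Lc : ℝ) ^ (k + 1) by rw [← pow_add, add_assoc], mul_pow, mul_inv,
        ← mul_assoc, mul_inv_cancel₀ (by positivity), one_mul]
    calc (((Lc ^ m : ℕ) : ℝ)) ^ (3 + 2) * (C * ((((Lc ^ (m + k + 1) : ℕ) : ℝ)) ^ (3 + 2))⁻¹) * Real.exp κ₀ *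
          Real.exp (-(κ₀ * supNorm (quo (Lc ^ (k + 1)) w' - z)))
        = C * Real.exp κ₀ * ((((Lc ^ m : ℕ) : ℝ)) ^ (3 + 2) * ((((Lc ^ (m + k + 1) : ℕ) : ℝ)) ^ (3 + 2))⁻¹) *
          Real.exp (-(κ₀ * supNorm (quo (Lc ^ (k + 1)) w' - z))) := by ring
      _ = _ := by rw [e]
  · -- (N1′) at the same blocking, envelope `A′ = C′·(N′^6)⁻¹`; `M^5·M·(N′^6)⁻¹ = (L^6)⁻¹`
    have hN : Lc ^ (m + k + 1) = Lc ^ m * Lc ^ (k + 1) := by rw [← pow_add, add_assoc]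
    have hA : 0 ≤ C' * ((((Lc ^ (m + k + 1) : ℕ) : ℝ)) ^ (3 + 3))⁻¹ := by positivity
    have h := abs_respStep_sub_le (d := 3) (M := Lc ^ m) (L := Lc ^ (k + 1)) hN hA hκ₀.le
      (fun κ l v ν => hN1' (m + k) κ l v ν) μ z l'' w' ν
    refine h.trans (le_of_eq ?_)
    have e : (((Lc ^ m : ℕ) : ℝ)) ^ (3 + 2) * (((Lc ^ m : ℕ) : ℝ)) * ((((Lc ^ (m + k + 1) : ℕ) : ℝ)) ^ (3 + 3))⁻¹
        = ((((Lc ^ (k + 1) : ℕ) : ℝ)) ^ (3 + 3))⁻¹ := by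
      push_cast
      rw [show (Lc : ℝ) ^ (m + k + 1) = (Lc : ℝ) ^ m * (Lc : ℝ) ^ (k + 1) by rw [← pow_add, add_assoc], mul_pow, mul_inv,
        show ((Lc : ℝ) ^ m) ^ (3 + 2) * (Lc : ℝ) ^ m = ((Lc : ℝ) ^ m) ^ (3 + 3) by ring,
        ← mul_assoc, mul_inv_cancel₀ (by positivity), one_mul]
    calc (((Lc ^ m : ℕ) : ℝ)) ^ (3 + 2) * (((Lc ^ m : ℕ) : ℝ)) * (C' * ((((Lc ^ (m + k + 1) : ℕ) : ℝ)) ^ (3 + 3))⁻¹) *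
          Real.exp (2 * κ₀) * Real.exp (-(κ₀ * supNorm (quo (Lc ^ (k + 1)) w' - z)))
        = C' * Real.exp (2 * κ₀) *
          ((((Lc ^ m : ℕ) : ℝ)) ^ (3 + 2) * (((Lc ^ m : ℕ) : ℝ)) * ((((Lc ^ (m + k + 1) : ℕ) : ℝ)) ^ (3 + 3))⁻¹) *
          Real.exp (-(κ₀ * supNorm (quo (Lc ^ (k + 1)) w' - z))) := by ring
      _ = _ := by rw [e]

end Four

end Summit.QuantumFields.BalabanUV.Beta.GAN24.RespStepDecay

end
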